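import Literature.Computability.Cryptography.QuantumTuringMachineWellFormed
import HarnessLib

/-!
# Local conditions for well-formedness of quantum Turing machines (Bernstein–Vazirani, Thm. 5.3), general machines

Bernstein–Vazirani, *Quantum complexity theory*, SIAM J. Comput. 26 (1997), §5.2, Thm. 5.3
(p. 1434): a QTM `M = (Σ, Q, δ)` is well formed (its time evolution preserves Euclidean length,
Def. 3.3) iff its local transition function satisfies

* **unit length** `‖δ(p, σ)‖ = 1` for all `(p, σ) ∈ Q × Σ`;
* **orthogonality** `δ(p₁, σ₁) · δ(p₂, σ₂) = 0` for `(p₁, σ₁) ≠ (p₂, σ₂)`;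
* **separability** `δ(p₁, σ₁ | τ₁, L) · δ(p₂, σ₂ | τ₂, R) = 0` for all `(pᵢ, σᵢ, τᵢ)`, where
  `δ(p, σ | τ, d) = ∑_q δ(p, σ, τ, q, d) |q⟩` is the direction-`d`-going *restricted
  superposition* (Def. 5.2).

(Ozawa–Nishimura, RAIRO Theor. Inform. Appl. 34 (2000), Thm. 4.5, is the same statement for
general QTMs whose head may also stay put; for two-way machines their condition (c) is void and
(d) is separability.)

This file proves the theorem, for ARBITRARY (not necessarily unidirectional) machines, in the
tree's model `Literature.Computability.Cryptography.QTM` (prelude Q8: Mathlib tapes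
`Turing.Tape`, finitely supported superpositions `M.Cfg →₀ ℂ`, `QTM.evolve`, `QTM.normSq`,
`QTM.IsWellFormed`). The sibling file `QuantumTuringMachineWellFormed.lean` proves the
criterion for UNIDIRECTIONAL machines (BV's remark after Thm. 5.3: unit length + orthogonality,
`QTM.isWellFormed_of_unidirectional`, `QTM.orthonormal_of_isWellFormed`,
`QTM.isWellFormed_of_deterministic`), where separability is void; here separability is the
point.

* `QTM.IsLocallyWellFormed M` — the three conditions, as printed (`QTM.updateNormSq`,
  `QTM.updateInner`, `QTM.restrictedInner`);
* `QTM.IsLocallyWellFormed.isWellFormed` — **sufficiency**, for every machine and every tape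
  alphabet;
* `QTM.IsWellFormed.isLocallyWellFormed` — **necessity**, for tape alphabets with at least two
  symbols (`[Nontrivial M.Γ]`), and `QTM.isWellFormed_iff_isLocallyWellFormed`;
* `QTM.isWellFormed_iff_gram` — the Gram form of well-formedness used in both directions:
  `‖U ψ‖² = ∑_{c₁,c₂} ψ c₁ conj(ψ c₂) G(c₁,c₂)` (`QTM.normSq_evolve`) with
  `G(c₁, c₂) = ∑_{u₁,u₂ : tgt c₁ u₁ = tgt c₂ u₂} δ(c₁,u₁) conj δ(c₂,u₂)` (`QTM.gram`), and `M` is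
  well formed iff `G(c₁, c₂) = [c₁ = c₂]`.

## The proof, as formalised (BV p. 1434)

"We know `M` is well formed iff … the columns of `U` have unit length and are mutually
orthogonal … configurations whose tapes differ in a cell not under either of their heads, or
whose tape heads are not either in the same cell or exactly two cells apart, cannot yield the
same configuration in a single step." Formally: two update triples `(q₁, b₁, d)`, `(q₂, b₂, d)`
with the SAME direction applied to `c₁`, `c₂` reach the same configuration iff `q₁ = q₂`,
`b₁ = b₂` and the tapes of `c₁`, `c₂` agree off the scanned cell (`QTM.updTarget_eq_iff_same`,
`Turing.Tape.move` is injective); these coincidences contribute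
`[tapes agree off the head] · δ(p₁,σ₁)·δ(p₂,σ₂)` to `G(c₁,c₂)` (`QTM.gramDir_same`,
`QTM.gramDir_false_add_true`). Coincidences between a LEFT-moving update of `c₁` and a
RIGHT-moving update of `c₂` contribute, for each pair of written symbols `(b₁, b₂)` for which
the two resulting tapes coincide, the separability product `δ(p₁,σ₁|b₁,L)·δ(p₂,σ₂|b₂,R)`
(`QTM.gramDir_ne`), which vanishes. Hence `G(c₁,c₂) = [c₁ = c₂]`
(`QTM.IsLocallyWellFormed.gram_eq`). Conversely (`[Nontrivial M.Γ]`, a symbol `a ≠ blank` serves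
as a marker), `G = [·=·]` evaluated on the configurations `(pᵢ, ⟨σᵢ, ε, a⟩)` gives unit length
and orthogonality (`QTM.gram_testCfg`), and on the pair `(p₁, ⟨σ₁, a τ₂, a⟩)`,
`(p₂, ⟨σ₂, ε, a τ₁ a⟩)` — the second head two cells to the left of the first, BV's third case —
gives separability (`QTM.gram_sepCfg`).

## Model remark: head-centred configurations (why `Nontrivial M.Γ`)

Bernstein–Vazirani configurations are triples (state, tape `ℤ → Σ`, head position); the tree's
`QTM.Cfg` is (state, `Turing.Tape`), the tape *relative to the head*, i.e. BV configurations
modulo translation, and `QTM.evolve` ADDS the amplitudes of translates (caveat recorded in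
`QuantumComplexity/QuantumTuringProofs.lean`, `QTM_blankCfg_move_left_eq_move_right` and the
`RotationWalk` example; BV's positioned model is `QuantumTuringMachinePositioned.lean`). In the
head-centred model a left-moving update of `c₁` and a right-moving update of `c₂` ALSO meet when
the tape of `c₂` is the tape of `c₁` read two cells further left — but these extra coincidences
contribute cross terms of exactly the separability shape, so they vanish too: **for tape
alphabets with at least two symbols the tree's well-formedness is equivalent to BV's three local
conditions** (`isWellFormed_iff_isLocallyWellFormed`), with no additional constraint. Over a
ONE-symbol alphabet all tapes coincide (`QTM.tape_unit_subsingleton`) and the tree's notion is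
strictly WEAKER: the machine `ModelExamples.halfHalf` (one state, all four amplitudes `1/2`) is
well formed in the tree (`halfHalf_isWellFormed`) but violates unit length, `‖δ‖² = 1/2`
(`not_isLocallyWellFormed_halfHalf`). Finally `ModelExamples.hadamardWalk` is a two-state
machine satisfying all three conditions (`hadamardWalk_isLocallyWellFormed`, so it is well formed
for BV and for the tree) for which one tree step FIXES the basis state `|q₁⟩`
(`hadamardWalk_evolve_single`: the translates `|q₁, ξ∓1⟩` of BV-amplitude `½` are identified,
the translates `|q₂, ξ∓1⟩` of amplitudes `±½` cancel), so that `QTM.acceptProbAt [] t = 1` for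
all `t` (`hadamardWalk_acceptProbAt`) against BV's `|½|² + |½|² = 1/2` at `t = 1` — a
well-formed instance of the translate interference that `RotationWalk` exhibits.

## References

* E. Bernstein, U. Vazirani, *Quantum complexity theory*, SIAM J. Comput. 26 (1997) 1411–1473
  [BernsteinVazirani1997SICOMP]: Def. 3.2–3.3 (QTM, well formed), Def. 5.2 and Thm. 5.3,
  p. 1434 (local conditions) with its proof. Read from the materialised text.
* M. Ozawa, H. Nishimura, *Local transition functions of quantum Turing machines*, RAIRO Theor.
  Inform. Appl. 34 (2000) 379–402 = arXiv:quant-ph/9811069 [OzawaNishimura1998], Thm. 4.5.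

## Not here

BV Thm. A.5 (length preservation already implies unitarity), the completion lemma (Lemma 5.7)
and the unidirection lemma (Lemma 5.5); the same theorem for the positioned model of
`QuantumTuringMachinePositioned.lean`.
-/

noncomputable section

namespace Literature.Computability.Cryptography

open Turing
open scoped BigOperators ComplexConjugate

namespace QTM

variable (M : QTM)

/-! ### The three local conditions -/

/-- `‖δ(p, σ)‖²`: the squared Euclidean length of the update superposition of the pair
(state `p`, scanned symbol `σ`), `∑_{q, τ, d} |δ(p, σ, τ, q, d)|²` (Bernstein–Vazirani 1997,
Thm. 5.3, "unit length"; the two directions written out). [cite: BernsteinVazirani1997SICOMP, Thm. 5.3] -/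
def updateNormSq (p : M.Λ) (σ : M.Γ) : ℝ :=
  ∑ q : M.Λ, ∑ τ : M.Γ, (‖M.δ p σ q τ Dir.left‖ ^ 2 + ‖M.δ p σ q τ Dir.right‖ ^ 2)

/-- `δ(p₁, σ₁) · δ(p₂, σ₂)`: the inner product of two update superpositions,
`∑_{q, τ, d} δ(p₁, σ₁, τ, q, d) conj δ(p₂, σ₂, τ, q, d)` (Bernstein–Vazirani 1997, Thm. 5.3,
"orthogonality"). [cite: BernsteinVazirani1997SICOMP, Thm. 5.3] -/
def updateInner (p₁ : M.Λ) (σ₁ : M.Γ) (p₂ : M.Λ) (σ₂ : M.Γ) : ℂ :=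
  ∑ q : M.Λ, ∑ τ : M.Γ, (M.δ p₁ σ₁ q τ Dir.left * conj (M.δ p₂ σ₂ q τ Dir.left) +
    M.δ p₁ σ₁ q τ Dir.right * conj (M.δ p₂ σ₂ q τ Dir.right))

/-- `δ(p₁, σ₁ | τ₁, d₁) · δ(p₂, σ₂ | τ₂, d₂)`: the inner product of two *restricted
superpositions* `δ(p, σ | τ, d) = ∑_q δ(p, σ, τ, q, d) |q⟩` (Bernstein–Vazirani 1997, Def. 5.2),
i.e. `∑_q δ(p₁, σ₁, τ₁, q, d₁) conj δ(p₂, σ₂, τ₂, q, d₂)`. [cite: BernsteinVazirani1997SICOMP, Def. 5.2] -/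
def restrictedInner (p₁ : M.Λ) (σ₁ τ₁ : M.Γ) (d₁ : Dir) (p₂ : M.Λ) (σ₂ τ₂ : M.Γ) (d₂ : Dir) :
    ℂ :=
  ∑ q : M.Λ, M.δ p₁ σ₁ q τ₁ d₁ * conj (M.δ p₂ σ₂ q τ₂ d₂)

/-- **The local well-formedness conditions** of Bernstein–Vazirani 1997, Thm. 5.3 (p. 1434):
unit length `‖δ(p, σ)‖ = 1` (stated as `‖δ(p, σ)‖² = 1`), orthogonality
`δ(p₁, σ₁) · δ(p₂, σ₂) = 0` for `(p₁, σ₁) ≠ (p₂, σ₂)`, and separability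
`δ(p₁, σ₁ | τ₁, L) · δ(p₂, σ₂ | τ₂, R) = 0` for all `(p₁, σ₁, τ₁), (p₂, σ₂, τ₂)`. [cite: BernsteinVazirani1997SICOMP, Thm. 5.3] -/
structure IsLocallyWellFormed : Prop where
  /-- unit length: `‖δ(p, σ)‖² = 1`. -/
  unit_length : ∀ (p : M.Λ) (σ : M.Γ), M.updateNormSq p σ = 1
  /-- orthogonality: `δ(p₁, σ₁) · δ(p₂, σ₂) = 0` for `(p₁, σ₁) ≠ (p₂, σ₂)`. -/
  orthogonality : ∀ (p₁ : M.Λ) (σ₁ : M.Γ) (p₂ : M.Λ) (σ₂ : M.Γ), (p₁, σ₁) ≠ (p₂, σ₂) →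
    M.updateInner p₁ σ₁ p₂ σ₂ = 0
  /-- separability: `δ(p₁, σ₁ | τ₁, L) · δ(p₂, σ₂ | τ₂, R) = 0`. -/
  separability : ∀ (p₁ : M.Λ) (σ₁ τ₁ : M.Γ) (p₂ : M.Λ) (σ₂ τ₂ : M.Γ),
    M.restrictedInner p₁ σ₁ τ₁ Dir.left p₂ σ₂ τ₂ Dir.right = 0

/-- `δ(p, σ) · δ(p, σ) = ‖δ(p, σ)‖²`. [folklore] -/
theorem updateInner_self (p : M.Λ) (σ : M.Γ) :
    M.updateInner p σ p σ = (M.updateNormSq p σ : ℂ) := by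
  unfold updateInner updateNormSq
  push_cast
  simp only [Complex.mul_conj']

/-! ### Update triples and the evolution as an indexed sum -/

/-- The finite type of update triples (direction, new state, written symbol) of `M`
(Bernstein–Vazirani 1997, Def. 3.2: `δ(p, σ) ∈ ℂ^{Σ × Q × {L, R}}`). [cite: BernsteinVazirani1997SICOMP, Def. 3.2] -/
abbrev Upd (M : QTM) : Type := Bool × M.Λ × M.Γ

/-- The configuration reached from `c` by the update triple `u`: write, change state, move
(Bernstein–Vazirani 1997, Def. 3.2). [cite: BernsteinVazirani1997SICOMP, Def. 3.2] -/
def updTarget (c : M.Cfg) (u : M.Upd) : M.Cfg :=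
  ⟨u.2.1, (c.tape.write u.2.2).move (dirOfBool u.1)⟩

/-- The amplitude of the update triple `u` in configuration `c`,
`δ(c.q, c.head, u)` (Bernstein–Vazirani 1997, Def. 3.2). [cite: BernsteinVazirani1997SICOMP, Def. 3.2] -/
def updAmp (c : M.Cfg) (u : M.Upd) : ℂ :=
  M.δ c.q c.tape.head u.2.1 u.2.2 (dirOfBool u.1)

/-- One step from a basis state, as a sum over update triples:
`U |c⟩ = ∑_u δ(c, u) |tgt(c, u)⟩` (Bernstein–Vazirani 1997, Def. 3.2). [cite: BernsteinVazirani1997SICOMP, Def. 3.2] -/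
theorem evolve_single_eq_sum (c : M.Cfg) (a : ℂ) :
    M.evolve (Finsupp.single c a) =
      ∑ u : M.Upd, (a * M.updAmp c u) • Finsupp.single (M.updTarget c u) (1 : ℂ) := by
  rw [evolve_single]
  simp only [Upd, Fintype.sum_prod_type, Fintype.sum_bool, updTarget, updAmp, dirOfBool_true,
    dirOfBool_false, Finset.sum_add_distrib]
  exact add_comm _ _

/-- Linearity of the evolution in the form `U ψ = ∑_{c ∈ supp ψ} U (ψ c |c⟩)`
(Bernstein–Vazirani 1997, Def. 3.2). [cite: BernsteinVazirani1997SICOMP, Def. 3.2] -/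
theorem evolve_eq_finsuppSum (ψ : M.Cfg →₀ ℂ) :
    M.evolve ψ = ψ.sum fun c a => M.evolve (Finsupp.single c a) := by
  unfold evolve
  simp only [Finsupp.sum_single_index, zero_mul, zero_smul, add_zero, Finset.sum_const_zero]

/-- The evolution of a finitely supported superposition as ONE indexed sum of scaled basis
states, indexed by (configuration in the support) × (update triple). [folklore] -/
theorem evolve_eq_sum (ψ : M.Cfg →₀ ℂ) :
    M.evolve ψ = ∑ i : ↥ψ.support × M.Upd,
      (ψ i.1 * M.updAmp i.1 i.2) • Finsupp.single (M.updTarget i.1 i.2) (1 : ℂ) := by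
  rw [Fintype.sum_prod_type, evolve_eq_finsuppSum]
  unfold Finsupp.sum
  rw [← Finset.sum_coe_sort]
  exact Finset.sum_congr rfl fun c _ => M.evolve_single_eq_sum c (ψ c)

/-! ### The Gram expansion of `‖U ψ‖²` -/

section gram

variable {ι α : Type*} [Fintype ι]

open Classical in
/-- Coefficients of an indexed combination of basis vectors:
`(∑ᵢ zᵢ |tᵢ⟩)(c) = ∑_{i : tᵢ = c} zᵢ`. [folklore] -/
theorem finsuppSum_apply (t : ι → α) (z : ι → ℂ) (c : α) :
    (∑ i, z i • Finsupp.single (t i) (1 : ℂ)) c = ∑ i, if t i = c then z i else 0 := by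
  rw [Finsupp.finsetSum_apply]
  refine Finset.sum_congr rfl fun i _ => ?_
  rw [Finsupp.smul_apply, Finsupp.single_apply, smul_eq_mul, mul_ite, mul_one, mul_zero]

open Classical in
/-- The support of `∑ᵢ zᵢ |tᵢ⟩` lies in the range of `t`. [folklore] -/
theorem support_finsuppSum_subset (t : ι → α) (z : ι → ℂ) :
    (∑ i, z i • Finsupp.single (t i) (1 : ℂ)).support ⊆ Finset.image t Finset.univ := by
  intro c hc
  rw [Finsupp.mem_support_iff, finsuppSum_apply] at hc
  obtain ⟨i, -, hi⟩ := Finset.exists_ne_zero_of_sum_ne_zero hc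
  rw [Finset.mem_image]
  refine ⟨i, Finset.mem_univ _, ?_⟩
  by_contra h
  exact hi (if_neg h)

end gram

open Classical in
/-- **Gram expansion.** For basis states `|tᵢ⟩` and amplitudes `zᵢ`,
`‖∑ᵢ zᵢ |tᵢ⟩‖² = ∑_{i, j : tᵢ = tⱼ} zᵢ conj zⱼ` (Parseval in the computational basis; the
squared norm `QTM.normSq` cast to `ℂ`). [folklore] -/
theorem normSq_finsuppSum {ι : Type*} [Fintype ι] (t : ι → M.Cfg) (z : ι → ℂ) :
    ((M.normSq (∑ i, z i • Finsupp.single (t i) (1 : ℂ)) : ℝ) : ℂ) =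
      ∑ i, ∑ j, if t i = t j then z i * conj (z j) else 0 := by
  set φ := ∑ i, z i • Finsupp.single (t i) (1 : ℂ) with hφ
  have hsupp : φ.support ⊆ Finset.image t Finset.univ := support_finsuppSum_subset t z
  unfold normSq
  rw [Finsupp.sum_of_support_subset φ hsupp _ (fun _ _ => by simp)]
  push_cast
  simp_rw [← Complex.mul_conj', hφ, finsuppSum_apply, map_sum, Finset.sum_mul_sum]
  rw [Finset.sum_comm]
  refine Finset.sum_congr rfl fun i _ => ?_
  rw [Finset.sum_comm]
  refine Finset.sum_congr rfl fun j _ => ?_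
  rw [Finset.sum_eq_single (t i)]
  · rw [if_pos rfl]
    by_cases h : t i = t j
    · rw [if_pos h, ← h, if_pos rfl]
    · rw [if_neg h, if_neg (Ne.symm h), map_zero, mul_zero]
  · intro c _ hc
    rw [if_neg (Ne.symm hc), zero_mul]
  · intro h
    exact absurd (Finset.mem_image_of_mem t (Finset.mem_univ i)) h

open Classical in
/-- **The Gram coefficient** of two configurations: the inner product of the columns `c₂` and
`c₁` of the time evolution matrix, `G(c₁, c₂) = ∑ δ(c₁, u₁) conj δ(c₂, u₂)` over the pairs of
update triples reaching the same configuration (Bernstein–Vazirani 1997, proof of Thm. 5.3: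
"the columns of `U` have unit length and are mutually orthogonal"). [cite: BernsteinVazirani1997SICOMP, Thm. 5.3 (proof)] -/
def gram (c₁ c₂ : M.Cfg) : ℂ :=
  ∑ u₁ : M.Upd, ∑ u₂ : M.Upd,
    if M.updTarget c₁ u₁ = M.updTarget c₂ u₂ then M.updAmp c₁ u₁ * conj (M.updAmp c₂ u₂) else 0

/-- **`‖U ψ‖²` as a Gram form**: `‖U ψ‖² = ∑_{c₁, c₂ ∈ supp ψ} ψ(c₁) conj ψ(c₂) G(c₁, c₂)`. [folklore] -/
theorem normSq_evolve (ψ : M.Cfg →₀ ℂ) :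
    ((M.normSq (M.evolve ψ) : ℝ) : ℂ) =
      ∑ c₁ ∈ ψ.support, ∑ c₂ ∈ ψ.support, ψ c₁ * conj (ψ c₂) * M.gram c₁ c₂ := by
  classical
  rw [evolve_eq_sum, normSq_finsuppSum, Fintype.sum_prod_type, ← Finset.sum_coe_sort ψ.support]
  refine Finset.sum_congr rfl fun c₁ _ => ?_
  rw [Finset.sum_comm, Fintype.sum_prod_type, ← Finset.sum_coe_sort ψ.support]
  refine Finset.sum_congr rfl fun c₂ _ => ?_
  rw [gram, Finset.mul_sum, Finset.sum_comm]
  refine Finset.sum_congr rfl fun u₁ _ => ?_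
  rw [Finset.mul_sum]
  refine Finset.sum_congr rfl fun u₂ _ => ?_
  split_ifs
  · simp only [map_mul]; ring
  · rw [mul_zero]

/-- `‖ψ‖² = ∑_{c ∈ supp ψ} ψ(c) conj ψ(c)` (cast to `ℂ`). [folklore] -/
theorem normSq_eq_sum (ψ : M.Cfg →₀ ℂ) :
    ((M.normSq ψ : ℝ) : ℂ) = ∑ c ∈ ψ.support, ψ c * conj (ψ c) := by
  unfold normSq Finsupp.sum
  push_cast
  simp only [Complex.mul_conj']

open Classical in
/-- If the Gram coefficients are `G(c₁, c₂) = [c₁ = c₂]` (orthonormal columns) then the time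
evolution preserves length (Bernstein–Vazirani 1997, proof of Thm. 5.3). [cite: BernsteinVazirani1997SICOMP, Thm. 5.3 (proof)] -/
theorem isWellFormed_of_gram (h : ∀ c₁ c₂ : M.Cfg, M.gram c₁ c₂ = if c₁ = c₂ then 1 else 0) :
    M.IsWellFormed := by
  intro ψ
  apply Complex.ofReal_injective
  rw [normSq_evolve, normSq_eq_sum]
  refine Finset.sum_congr rfl fun c₁ hc₁ => ?_
  simp_rw [h, mul_ite, mul_one, mul_zero]
  rw [Finset.sum_ite_eq, if_pos hc₁]

/-! ### Which update triples reach the same configuration -/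

/-- Writing replaces the scanned symbol: `T.write b = ⟨b, T.left, T.right⟩`. [folklore] -/
theorem tape_write_eq_mk (T : Tape M.Γ) (b : M.Γ) : T.write b = ⟨b, T.left, T.right⟩ := by
  cases T; rfl

/-- Two tapes *agree off the head* if their left and right parts coincide (they differ at most
in the scanned symbol). [folklore] -/
def SameOffHead (T₁ T₂ : Tape M.Γ) : Prop := T₁.left = T₂.left ∧ T₁.right = T₂.right

/-- **Same direction.** Update triples with the same direction applied to `c₁`, `c₂` reach the
same configuration iff they enter the same state, write the same symbol, and the tapes of `c₁`,
`c₂` agree off the head (Bernstein–Vazirani 1997, proof of Thm. 5.3, second case). [cite: BernsteinVazirani1997SICOMP, Thm. 5.3 (proof)] -/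
theorem updTarget_eq_iff_same (c₁ c₂ : M.Cfg) (e : Bool) (q₁ q₂ : M.Λ) (b₁ b₂ : M.Γ) :
    M.updTarget c₁ (e, q₁, b₁) = M.updTarget c₂ (e, q₂, b₂) ↔
      q₁ = q₂ ∧ b₁ = b₂ ∧ M.SameOffHead c₁.tape c₂.tape := by
  have hinj : ∀ T₁ T₂ : Tape M.Γ, T₁.move (dirOfBool e) = T₂.move (dirOfBool e) ↔ T₁ = T₂ :=
    fun T₁ T₂ => (tape_move_injective (Γ := M.Γ) (dirOfBool e)).eq_iff
  simp only [updTarget, Cfg.mk.injEq, hinj, tape_write_eq_mk, Tape.mk.injEq, SameOffHead]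

/-- In general two update triples reach the same configuration iff they enter the same state and
produce the same (head-centred) tape. [folklore] -/
theorem updTarget_eq_iff (c₁ c₂ : M.Cfg) (e₁ e₂ : Bool) (q₁ q₂ : M.Λ) (b₁ b₂ : M.Γ) :
    M.updTarget c₁ (e₁, q₁, b₁) = M.updTarget c₂ (e₂, q₂, b₂) ↔
      q₁ = q₂ ∧ (c₁.tape.write b₁).move (dirOfBool e₁) =
        (c₂.tape.write b₂).move (dirOfBool e₂) := by
  simp only [updTarget, Cfg.mk.injEq]

open Classical in
/-- The part of the Gram coefficient `G(c₁, c₂)` contributed by update triples of `c₁` with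
direction `e₁` and of `c₂` with direction `e₂`. [folklore] -/
def gramDir (c₁ c₂ : M.Cfg) (e₁ e₂ : Bool) : ℂ :=
  ∑ q₁ : M.Λ, ∑ b₁ : M.Γ, ∑ q₂ : M.Λ, ∑ b₂ : M.Γ,
    if M.updTarget c₁ (e₁, q₁, b₁) = M.updTarget c₂ (e₂, q₂, b₂) then
      M.updAmp c₁ (e₁, q₁, b₁) * conj (M.updAmp c₂ (e₂, q₂, b₂)) else 0

/-- `G(c₁, c₂)` split according to the four pairs of directions. [folklore] -/
theorem gram_eq_sum_gramDir (c₁ c₂ : M.Cfg) :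
    M.gram c₁ c₂ = M.gramDir c₁ c₂ false false + M.gramDir c₁ c₂ false true +
      (M.gramDir c₁ c₂ true false + M.gramDir c₁ c₂ true true) := by
  simp only [gram, gramDir, Upd, Fintype.sum_prod_type, Fintype.sum_bool, Finset.sum_add_distrib]
  abel

section sums

variable {β γ : Type*} [Fintype β] [DecidableEq β]

/-- Pulling a constant condition out of a finite sum. [folklore] -/
theorem sum_ite_const {s : Finset γ} (P : Prop) [Decidable P] (f : γ → ℂ) :
    (∑ x ∈ s, if P then f x else 0) = if P then ∑ x ∈ s, f x else 0 := by
  split_ifs <;> simp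

variable [Fintype γ]

/-- Collapsing a double sum along an equality test on the first index. [folklore] -/
theorem sum_sum_ite_eq_and (a : β) (P : β → γ → Prop) [∀ x y, Decidable (P x y)]
    (f : β → γ → ℂ) :
    (∑ x : β, ∑ y : γ, if a = x ∧ P x y then f x y else 0) =
      ∑ y : γ, if P a y then f a y else 0 := by
  rw [Finset.sum_eq_single a]
  · simp only [true_and]
  · intro x _ hx
    exact Finset.sum_eq_zero fun y _ => if_neg fun h => hx h.1.symm
  · intro h; exact absurd (Finset.mem_univ a) h

/-- Collapsing a sum along an equality test on the index. [folklore] -/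
theorem sum_ite_eq_and (a : β) (P : β → Prop) [∀ x, Decidable (P x)] (f : β → ℂ) :
    (∑ x : β, if a = x ∧ P x then f x else 0) = if P a then f a else 0 := by
  rw [Finset.sum_eq_single a]
  · simp only [true_and]
  · intro x _ hx
    exact if_neg fun h => hx h.1.symm
  · intro h; exact absurd (Finset.mem_univ a) h

end sums

open Classical in
/-- **Same-direction contributions**: `[tapes agree off the head] · ∑_{q, b} δ(c₁; q, b, d) conj
δ(c₂; q, b, d)` (Bernstein–Vazirani 1997, proof of Thm. 5.3, second case). [cite: BernsteinVazirani1997SICOMP, Thm. 5.3 (proof)] -/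
theorem gramDir_same (c₁ c₂ : M.Cfg) (e : Bool) :
    M.gramDir c₁ c₂ e e = if M.SameOffHead c₁.tape c₂.tape then
      ∑ q : M.Λ, ∑ b : M.Γ, M.updAmp c₁ (e, q, b) * conj (M.updAmp c₂ (e, q, b)) else 0 := by
  unfold gramDir
  simp_rw [updTarget_eq_iff_same, sum_sum_ite_eq_and, sum_ite_eq_and, sum_ite_const]

open Classical in
/-- **Mixed-direction contributions**: for each pair of written symbols whose resulting tapes
coincide, the restricted-superposition product `∑_q δ(c₁; q, b₁, d₁) conj δ(c₂; q, b₂, d₂)`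
(Bernstein–Vazirani 1997, proof of Thm. 5.3, third case). [cite: BernsteinVazirani1997SICOMP, Thm. 5.3 (proof)] -/
theorem gramDir_ne (c₁ c₂ : M.Cfg) (e₁ e₂ : Bool) :
    M.gramDir c₁ c₂ e₁ e₂ = ∑ b₁ : M.Γ, ∑ b₂ : M.Γ,
      if (c₁.tape.write b₁).move (dirOfBool e₁) = (c₂.tape.write b₂).move (dirOfBool e₂) then
        ∑ q : M.Λ, M.updAmp c₁ (e₁, q, b₁) * conj (M.updAmp c₂ (e₂, q, b₂)) else 0 := by
  unfold gramDir
  simp_rw [updTarget_eq_iff, sum_sum_ite_eq_and]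
  rw [Finset.sum_comm]
  refine Finset.sum_congr rfl fun b₁ _ => ?_
  rw [Finset.sum_comm]
  refine Finset.sum_congr rfl fun b₂ _ => ?_
  rw [sum_ite_const]

variable {M}

/-- Separability kills the (left of `c₁`, right of `c₂`) contributions. [cite: BernsteinVazirani1997SICOMP, Thm. 5.3 (proof)] -/
theorem IsLocallyWellFormed.gramDir_left_right (h : M.IsLocallyWellFormed) (c₁ c₂ : M.Cfg) :
    M.gramDir c₁ c₂ false true = 0 := by
  rw [gramDir_ne]
  refine Finset.sum_eq_zero fun b₁ _ => Finset.sum_eq_zero fun b₂ _ => ?_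
  have := h.separability c₁.q c₁.tape.head b₁ c₂.q c₂.tape.head b₂
  unfold restrictedInner at this
  simp only [updAmp, dirOfBool_false, dirOfBool_true, this, ite_self]

/-- Separability (conjugated, with the roles of `c₁`, `c₂` exchanged) kills the (right of `c₁`,
left of `c₂`) contributions. [cite: BernsteinVazirani1997SICOMP, Thm. 5.3 (proof)] -/
theorem IsLocallyWellFormed.gramDir_right_left (h : M.IsLocallyWellFormed) (c₁ c₂ : M.Cfg) :
    M.gramDir c₁ c₂ true false = 0 := by
  rw [gramDir_ne]
  refine Finset.sum_eq_zero fun b₁ _ => Finset.sum_eq_zero fun b₂ _ => ?_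
  have h0 := h.separability c₂.q c₂.tape.head b₂ c₁.q c₁.tape.head b₁
  unfold restrictedInner at h0
  have h1 : ∑ q : M.Λ, M.updAmp c₁ (true, q, b₁) * conj (M.updAmp c₂ (false, q, b₂)) =
      conj (∑ q : M.Λ, M.δ c₂.q c₂.tape.head q b₂ Dir.left *
        conj (M.δ c₁.q c₁.tape.head q b₁ Dir.right)) := by
    rw [map_sum]
    refine Finset.sum_congr rfl fun q _ => ?_
    simp only [updAmp, dirOfBool_false, dirOfBool_true, map_mul, Complex.conj_conj]
    ring
  simp only [h1, h0, map_zero, ite_self]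

variable (M)

/-- When the tapes agree off the head, the two same-direction contributions add up to
`δ(p₁, σ₁) · δ(p₂, σ₂)`. [cite: BernsteinVazirani1997SICOMP, Thm. 5.3 (proof)] -/
theorem gramDir_false_add_true (c₁ c₂ : M.Cfg) (hS : M.SameOffHead c₁.tape c₂.tape) :
    M.gramDir c₁ c₂ false false + M.gramDir c₁ c₂ true true =
      M.updateInner c₁.q c₁.tape.head c₂.q c₂.tape.head := by
  classical
  rw [gramDir_same, gramDir_same, if_pos hS, if_pos hS, updateInner, ← Finset.sum_add_distrib]
  refine Finset.sum_congr rfl fun q _ => ?_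
  rw [← Finset.sum_add_distrib]
  rfl

open Classical in
/-- **The Gram coefficients of a locally well-formed QTM are those of an isometry**:
`G(c₁, c₂) = [c₁ = c₂]` (Bernstein–Vazirani 1997, proof of Thm. 5.3). [cite: BernsteinVazirani1997SICOMP, Thm. 5.3 (proof)] -/
theorem IsLocallyWellFormed.gram_eq {M : QTM} (h : M.IsLocallyWellFormed) (c₁ c₂ : M.Cfg) :
    M.gram c₁ c₂ = if c₁ = c₂ then 1 else 0 := by
  rw [gram_eq_sum_gramDir, h.gramDir_left_right, h.gramDir_right_left, add_zero, zero_add]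
  by_cases hS : M.SameOffHead c₁.tape c₂.tape
  · rw [M.gramDir_false_add_true c₁ c₂ hS]
    by_cases hps : (c₁.q, c₁.tape.head) = (c₂.q, c₂.tape.head)
    · obtain ⟨hq, hh⟩ := Prod.mk.injEq _ _ _ _ ▸ hps
      have hc : c₁ = c₂ := by
        obtain ⟨q₁, T₁⟩ := c₁
        obtain ⟨q₂, T₂⟩ := c₂
        obtain ⟨a₁, L₁, R₁⟩ := T₁
        obtain ⟨a₂, L₂, R₂⟩ := T₂
        simp only [SameOffHead] at hq hh hS
        simp [hq, hh, hS.1, hS.2]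
      rw [if_pos hc, ← hq, ← hh, updateInner_self, h.unit_length, Complex.ofReal_one]
    · have hc : c₁ ≠ c₂ := by
        rintro rfl
        exact hps rfl
      rw [if_neg hc, h.orthogonality _ _ _ _ hps]
  · rw [gramDir_same, gramDir_same, if_neg hS, if_neg hS, add_zero, if_neg]
    rintro rfl
    exact hS ⟨rfl, rfl⟩

/-- **Bernstein–Vazirani 1997, Theorem 5.3 (sufficiency, p. 1434).** A QTM whose local
transition function satisfies unit length, orthogonality and separability is well formed: its
time evolution preserves the length of every finitely supported superposition. Holds for every
tape alphabet. [cite: BernsteinVazirani1997SICOMP, Thm. 5.3] -/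
theorem IsLocallyWellFormed.isWellFormed {M : QTM} (h : M.IsLocallyWellFormed) :
    M.IsWellFormed :=
  M.isWellFormed_of_gram h.gram_eq

/-! ### Necessity of the local conditions (alphabets with at least two symbols) -/

/-- The Gram form over any finite set containing the support. [folklore] -/
theorem normSq_evolve_of_subset (ψ : M.Cfg →₀ ℂ) {S : Finset M.Cfg} (hS : ψ.support ⊆ S) :
    ((M.normSq (M.evolve ψ) : ℝ) : ℂ) =
      ∑ c₁ ∈ S, ∑ c₂ ∈ S, ψ c₁ * conj (ψ c₂) * M.gram c₁ c₂ := by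
  rw [normSq_evolve]
  rw [Finset.sum_subset hS]
  · refine Finset.sum_congr rfl fun c₁ _ => Finset.sum_subset hS fun c₂ _ hc₂ => ?_
    rw [Finsupp.notMem_support_iff.1 hc₂, map_zero, mul_zero, zero_mul]
  · intro c₁ _ hc₁
    exact Finset.sum_eq_zero fun c₂ _ => by
      rw [Finsupp.notMem_support_iff.1 hc₁, zero_mul, zero_mul]

/-- `‖ψ‖²` over any finite set containing the support. [folklore] -/
theorem normSq_eq_sum_of_subset (ψ : M.Cfg →₀ ℂ) {S : Finset M.Cfg} (hS : ψ.support ⊆ S) :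
    ((M.normSq ψ : ℝ) : ℂ) = ∑ c ∈ S, ψ c * conj (ψ c) := by
  rw [normSq_eq_sum]
  exact Finset.sum_subset hS fun c _ hc => by
    rw [Finsupp.notMem_support_iff.1 hc, zero_mul]

variable {M}

/-- For a well-formed QTM the diagonal Gram coefficients are `1` (columns of unit length).
[cite: BernsteinVazirani1997SICOMP, Thm. 5.3 (proof)] -/
theorem IsWellFormed.gram_self (h : M.IsWellFormed) (c : M.Cfg) : M.gram c c = 1 := by
  classical
  have hψ : ((M.normSq (M.evolve (Finsupp.single c 1)) : ℝ) : ℂ) =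
      ((M.normSq (Finsupp.single c 1) : ℝ) : ℂ) := by rw [h]
  have hS : (Finsupp.single c (1 : ℂ)).support ⊆ {c} := Finsupp.support_single_subset
  rw [M.normSq_evolve_of_subset _ hS, M.normSq_eq_sum_of_subset _ hS] at hψ
  simpa using hψ

/-- For a well-formed QTM the off-diagonal Gram coefficients vanish (mutually orthogonal
columns); polarisation with the superpositions `|c₁⟩ + w |c₂⟩`, `w = 1, i`.
[cite: BernsteinVazirani1997SICOMP, Thm. 5.3 (proof)] -/
theorem IsWellFormed.gram_eq_zero (h : M.IsWellFormed) {c₁ c₂ : M.Cfg} (hne : c₁ ≠ c₂) :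
    M.gram c₁ c₂ = 0 := by
  classical
  have key : ∀ w : ℂ, conj w * M.gram c₁ c₂ + w * M.gram c₂ c₁ = 0 := by
    intro w
    set ψ : M.Cfg →₀ ℂ := Finsupp.single c₁ 1 + Finsupp.single c₂ w with hψdef
    have hS : ψ.support ⊆ {c₁, c₂} := by
      refine Finsupp.support_add.trans (Finset.union_subset ?_ ?_)
      · exact Finsupp.support_single_subset.trans (by simp)
      · exact Finsupp.support_single_subset.trans (by simp)
    have h1 : ψ c₁ = 1 := by simp [hψdef, Ne.symm hne]
    have h2 : ψ c₂ = w := by simp [hψdef, hne]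
    have hψ : ((M.normSq (M.evolve ψ) : ℝ) : ℂ) = ((M.normSq ψ : ℝ) : ℂ) := by rw [h]
    rw [M.normSq_evolve_of_subset _ hS, M.normSq_eq_sum_of_subset _ hS,
      Finset.sum_insert (by simpa using hne), Finset.sum_singleton,
      Finset.sum_insert (by simpa using hne), Finset.sum_singleton,
      Finset.sum_insert (by simpa using hne), Finset.sum_singleton,
      Finset.sum_insert (by simpa using hne), Finset.sum_singleton, h1, h2,
      h.gram_self, h.gram_self] at hψ
    simp only [map_one, one_mul, mul_one] at hψ
    linear_combination hψ
  have e1 := key 1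
  have e2 := key Complex.I
  simp only [map_one, one_mul, Complex.conj_I] at e1 e2
  have hI : Complex.I ≠ 0 := Complex.I_ne_zero
  have : (2 : ℂ) * Complex.I * M.gram c₁ c₂ = 0 := by linear_combination Complex.I * e1 - e2
  simpa [hI] using this

open Classical in
/-- **Gram form of well-formedness**: `M` is well formed iff `G(c₁, c₂) = [c₁ = c₂]` for all
configurations, i.e. iff the columns of the time evolution matrix are orthonormal
(Bernstein–Vazirani 1997, proof of Thm. 5.3, first sentence). [cite: BernsteinVazirani1997SICOMP, Thm. 5.3 (proof)] -/
theorem isWellFormed_iff_gram :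
    M.IsWellFormed ↔ ∀ c₁ c₂ : M.Cfg, M.gram c₁ c₂ = if c₁ = c₂ then 1 else 0 := by
  refine ⟨fun h c₁ c₂ => ?_, M.isWellFormed_of_gram⟩
  split_ifs with hc
  · subst hc; exact h.gram_self c₁
  · exact h.gram_eq_zero hc

section necessity

variable (M)

/-- `Turing.Tape.move L` on an explicit tape. [folklore] -/
theorem tape_move_left_mk (a : M.Γ) (L R : ListBlank M.Γ) :
    Tape.move Dir.left (⟨a, L, R⟩ : Tape M.Γ) = ⟨L.head, L.tail, R.cons a⟩ := rfl

/-- `Turing.Tape.move R` on an explicit tape. [folklore] -/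
theorem tape_move_right_mk (a : M.Γ) (L R : ListBlank M.Γ) :
    Tape.move Dir.right (⟨a, L, R⟩ : Tape M.Γ) = ⟨R.head, L.cons a, R.tail⟩ := rfl

/-- Blank-padded lists with the same tail are equal iff their heads are. [folklore] -/
theorem listBlank_mk_cons_inj {x y : M.Γ} {l : List M.Γ} :
    (ListBlank.mk (x :: l) : ListBlank M.Γ) = ListBlank.mk (y :: l) ↔ x = y := by
  refine ⟨fun h => ?_, fun h => by rw [h]⟩
  have := congrArg (fun L : ListBlank M.Γ => L.nth 0) h
  simpa [ListBlank.nth_mk] using this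

/-- A blank-padded list with a non-blank second entry is not blank. [folklore] -/
theorem listBlank_mk_cons_cons_ne_nil (x : M.Γ) {a : M.Γ} (ha : a ≠ default) (l : List M.Γ) :
    (ListBlank.mk (x :: a :: l) : ListBlank M.Γ) ≠ ListBlank.mk [] := by
  intro h
  have := congrArg (fun L : ListBlank M.Γ => L.nth 1) h
  simp at this
  exact ha this

/-- A blank-padded list with a non-blank first entry is not blank. [folklore] -/
theorem listBlank_mk_cons_ne_nil {a : M.Γ} (ha : a ≠ default) (l : List M.Γ) :
    (ListBlank.mk (a :: l) : ListBlank M.Γ) ≠ ListBlank.mk [] := by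
  intro h
  have := congrArg (fun L : ListBlank M.Γ => L.nth 0) h
  simp at this
  exact ha this

/-- Test configuration for unit length and orthogonality: state `p`, scanned symbol `σ`, blank
left part, one marker `a` to the right of the head (so that no left-moving update of one test
configuration meets a right-moving update of another). [folklore] -/
def testCfg (a : M.Γ) (p : M.Λ) (σ : M.Γ) : M.Cfg :=
  ⟨p, ⟨σ, ListBlank.mk [], ListBlank.mk [a]⟩⟩

/-- On test configurations the Gram coefficient is `δ(p₁, σ₁) · δ(p₂, σ₂)` (marker
`a ≠ blank`). [cite: BernsteinVazirani1997SICOMP, Thm. 5.3 (proof)] -/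
theorem gram_testCfg {a : M.Γ} (ha : a ≠ default) (p₁ : M.Λ) (σ₁ : M.Γ) (p₂ : M.Λ) (σ₂ : M.Γ) :
    M.gram (M.testCfg a p₁ σ₁) (M.testCfg a p₂ σ₂) = M.updateInner p₁ σ₁ p₂ σ₂ := by
  classical
  have hS : M.SameOffHead (M.testCfg a p₁ σ₁).tape (M.testCfg a p₂ σ₂).tape := ⟨rfl, rfl⟩
  have h01 : M.gramDir (M.testCfg a p₁ σ₁) (M.testCfg a p₂ σ₂) false true = 0 := by
    rw [gramDir_ne]
    refine Finset.sum_eq_zero fun b₁ _ => Finset.sum_eq_zero fun b₂ _ => if_neg fun h => ?_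
    have h' := congrArg Tape.right h
    simp only [testCfg, Tape.write_mk, dirOfBool_false, dirOfBool_true, tape_move_left_mk,
      tape_move_right_mk, ListBlank.cons_mk, ListBlank.tail_mk, List.tail_cons] at h'
    exact M.listBlank_mk_cons_cons_ne_nil b₁ ha [] h'
  have h10 : M.gramDir (M.testCfg a p₁ σ₁) (M.testCfg a p₂ σ₂) true false = 0 := by
    rw [gramDir_ne]
    refine Finset.sum_eq_zero fun b₁ _ => Finset.sum_eq_zero fun b₂ _ => if_neg fun h => ?_
    have h' := congrArg Tape.right h
    simp only [testCfg, Tape.write_mk, dirOfBool_false, dirOfBool_true, tape_move_left_mk,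
      tape_move_right_mk, ListBlank.cons_mk, ListBlank.tail_mk, List.tail_cons] at h'
    exact M.listBlank_mk_cons_cons_ne_nil b₂ ha [] h'.symm
  rw [gram_eq_sum_gramDir, h01, h10, add_zero, zero_add, M.gramDir_false_add_true _ _ hS]
  rfl

/-- First test configuration for separability: state `p₁` scanning `σ₁`, with `a τ₂` to the
left and the marker `a` to the right (Bernstein–Vazirani 1997, proof of Thm. 5.3, third case).
[cite: BernsteinVazirani1997SICOMP, Thm. 5.3 (proof)] -/
def sepCfg₁ (a : M.Γ) (p₁ : M.Λ) (σ₁ τ₂ : M.Γ) : M.Cfg :=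
  ⟨p₁, ⟨σ₁, ListBlank.mk [a, τ₂], ListBlank.mk [a]⟩⟩

/-- Second test configuration for separability: its head two cells to the LEFT of that of
`sepCfg₁` relative to the common content, state `p₂` scanning `σ₂`, with `a τ₁ a` to the right:
writing `τ₁` and moving left from `sepCfg₁` reaches the same configuration as writing `τ₂` and
moving right from `sepCfg₂`, and these are the only coincidences (Bernstein–Vazirani 1997,
proof of Thm. 5.3, third case). [cite: BernsteinVazirani1997SICOMP, Thm. 5.3 (proof)] -/
def sepCfg₂ (a : M.Γ) (p₂ : M.Λ) (σ₂ τ₁ : M.Γ) : M.Cfg :=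
  ⟨p₂, ⟨σ₂, ListBlank.mk [], ListBlank.mk [a, τ₁, a]⟩⟩

/-- On the separability test pair the Gram coefficient is exactly the separability product
`δ(p₁, σ₁ | τ₁, L) · δ(p₂, σ₂ | τ₂, R)` (marker `a ≠ blank`). [cite: BernsteinVazirani1997SICOMP, Thm. 5.3 (proof)] -/
theorem gram_sepCfg {a : M.Γ} (ha : a ≠ default) (p₁ : M.Λ) (σ₁ τ₁ : M.Γ) (p₂ : M.Λ)
    (σ₂ τ₂ : M.Γ) :
    M.gram (M.sepCfg₁ a p₁ σ₁ τ₂) (M.sepCfg₂ a p₂ σ₂ τ₁) =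
      M.restrictedInner p₁ σ₁ τ₁ Dir.left p₂ σ₂ τ₂ Dir.right := by
  classical
  have hS : ¬ M.SameOffHead (M.sepCfg₁ a p₁ σ₁ τ₂).tape (M.sepCfg₂ a p₂ σ₂ τ₁).tape := fun h =>
    M.listBlank_mk_cons_ne_nil ha [τ₂] h.1
  have h10 : M.gramDir (M.sepCfg₁ a p₁ σ₁ τ₂) (M.sepCfg₂ a p₂ σ₂ τ₁) true false = 0 := by
    rw [gramDir_ne]
    refine Finset.sum_eq_zero fun b₁ _ => Finset.sum_eq_zero fun b₂ _ => if_neg fun h => ?_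
    have h' := congrArg Tape.right h
    simp only [sepCfg₁, sepCfg₂, Tape.write_mk, dirOfBool_false, dirOfBool_true,
      tape_move_left_mk, tape_move_right_mk, ListBlank.cons_mk, ListBlank.tail_mk,
      List.tail_cons] at h'
    exact M.listBlank_mk_cons_cons_ne_nil b₂ ha _ h'.symm
  have hcond : ∀ b₁ b₂ : M.Γ,
      ((M.sepCfg₁ a p₁ σ₁ τ₂).tape.write b₁).move (dirOfBool false) =
        ((M.sepCfg₂ a p₂ σ₂ τ₁).tape.write b₂).move (dirOfBool true) ↔ τ₁ = b₁ ∧ τ₂ = b₂ := by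
    intro b₁ b₂
    simp only [sepCfg₁, sepCfg₂, Tape.write_mk, dirOfBool_false, dirOfBool_true,
      tape_move_left_mk, tape_move_right_mk, ListBlank.cons_mk, ListBlank.tail_mk,
      ListBlank.head_mk, List.tail_cons, List.headI_cons, Tape.mk.injEq, true_and,
      listBlank_mk_cons_inj]
    tauto
  have h01 : M.gramDir (M.sepCfg₁ a p₁ σ₁ τ₂) (M.sepCfg₂ a p₂ σ₂ τ₁) false true =
      M.restrictedInner p₁ σ₁ τ₁ Dir.left p₂ σ₂ τ₂ Dir.right := by
    rw [gramDir_ne]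
    simp_rw [hcond, sum_sum_ite_eq_and, Finset.sum_ite_eq, Finset.mem_univ, if_true]
    rfl
  rw [gram_eq_sum_gramDir, h01, h10, zero_add, gramDir_same, gramDir_same, if_neg hS, if_neg hS,
    zero_add, add_zero]

variable {M}

/-- **Bernstein–Vazirani 1997, Theorem 5.3 (necessity, p. 1434)**, for tape alphabets with at
least two symbols: a well-formed QTM satisfies unit length, orthogonality and separability. (For
a one-symbol alphabet this fails in the tree's head-centred model, see
`QTM.ModelExamples.not_isLocallyWellFormed_halfHalf`.) [cite: BernsteinVazirani1997SICOMP, Thm. 5.3] -/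
theorem IsWellFormed.isLocallyWellFormed [Nontrivial M.Γ] (h : M.IsWellFormed) :
    M.IsLocallyWellFormed := by
  obtain ⟨a, ha⟩ := exists_ne (default : M.Γ)
  refine ⟨fun p σ => ?_, fun p₁ σ₁ p₂ σ₂ hne => ?_, fun p₁ σ₁ τ₁ p₂ σ₂ τ₂ => ?_⟩
  · have h1 := h.gram_self (M.testCfg a p σ)
    rw [M.gram_testCfg ha, updateInner_self] at h1
    exact_mod_cast h1
  · have hc : M.testCfg a p₁ σ₁ ≠ M.testCfg a p₂ σ₂ := by
      intro e
      simp only [testCfg, Cfg.mk.injEq, Tape.mk.injEq, and_true] at e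
      exact hne (by rw [e.1, e.2])
    rw [← M.gram_testCfg ha, h.gram_eq_zero hc]
  · have hc : M.sepCfg₁ a p₁ σ₁ τ₂ ≠ M.sepCfg₂ a p₂ σ₂ τ₁ := by
      intro e
      simp only [sepCfg₁, sepCfg₂, Cfg.mk.injEq, Tape.mk.injEq] at e
      exact M.listBlank_mk_cons_ne_nil ha [τ₂] e.2.2.1
    rw [← M.gram_sepCfg ha, h.gram_eq_zero hc]

/-- **Bernstein–Vazirani 1997, Theorem 5.3** for the tree's quantum Turing machines over a tape
alphabet with at least two symbols: `M` is well formed iff its local transition function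
satisfies unit length, orthogonality and separability. [cite: BernsteinVazirani1997SICOMP, Thm. 5.3] -/
theorem isWellFormed_iff_isLocallyWellFormed [Nontrivial M.Γ] :
    M.IsWellFormed ↔ M.IsLocallyWellFormed :=
  ⟨IsWellFormed.isLocallyWellFormed, fun h => h.isWellFormed⟩

end necessity

/-- Over the one-symbol alphabet `Unit` all Mathlib tapes coincide (blank-padded lists of `()`
are all equal): the tree's head-centred configuration space forgets everything but the control
state. [folklore] -/
theorem tape_unit_subsingleton : Subsingleton (Tape Unit) :=
  ⟨fun T₁ T₂ => by
    obtain ⟨a, L, R⟩ := T₁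
    obtain ⟨a', L', R'⟩ := T₂
    congr 1 <;> exact ListBlank.ext fun _ => Subsingleton.elim _ _⟩

/-! ### Model examples: the one-symbol alphabet, and translate interference -/

namespace ModelExamples

/-- The machine with one control state, the one-symbol alphabet and all four amplitudes
`δ((), () ; (), (), d) = 1/2`, `d = L, R`. In Bernstein–Vazirani's model it violates unit length
(`‖δ‖² = 1/2`); in the tree's head-centred model it is well formed. [folklore] -/
def halfHalf : QTM where
  Λ := Unit
  Γ := Unit
  start := ()
  accept := ()
  embed := fun _ => ()
  δ := fun _ _ _ _ _ => 1 / 2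

/-- All configurations of `halfHalf` coincide. [folklore] -/
theorem halfHalf_cfg_subsingleton : Subsingleton halfHalf.Cfg :=
  ⟨fun c₁ c₂ => by
    obtain ⟨q₁, T₁⟩ := c₁
    obtain ⟨q₂, T₂⟩ := c₂
    have hT : T₁ = T₂ := (tape_unit_subsingleton).elim T₁ T₂
    cases hT
    rfl⟩

/-- `halfHalf` is well formed in the tree's model: its single configuration is mapped to
itself with amplitude `4 · (1/2 · 1/2) = 1`... precisely, `G(c, c) = ∑_{u₁, u₂} ¼ = 1`. [folklore] -/
theorem halfHalf_isWellFormed : halfHalf.IsWellFormed := by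
  classical
  haveI := halfHalf_cfg_subsingleton
  refine halfHalf.isWellFormed_of_gram fun c₁ c₂ => ?_
  have hamp : ∀ (c : halfHalf.Cfg) (u : halfHalf.Upd), halfHalf.updAmp c u = 1 / 2 :=
    fun _ _ => rfl
  have htgt : ∀ (u₁ u₂ : halfHalf.Upd), (halfHalf.updTarget c₁ u₁ = halfHalf.updTarget c₂ u₂) ↔
      True :=
    fun _ _ => iff_true_intro (Subsingleton.elim _ _)
  rw [if_pos (Subsingleton.elim c₁ c₂), gram]
  simp only [htgt, if_true, hamp, Finset.sum_const, Finset.card_univ, map_div₀, map_one, map_ofNat]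
  have hcard : Fintype.card halfHalf.Upd = 2 := rfl
  rw [hcard]
  norm_num

/-- `halfHalf` violates unit length: `‖δ((), ())‖² = 1/2`. Hence the hypothesis
`[Nontrivial M.Γ]` of `QTM.IsWellFormed.isLocallyWellFormed` cannot be dropped in the tree's
model. [folklore] -/
theorem not_isLocallyWellFormed_halfHalf : ¬ halfHalf.IsLocallyWellFormed := by
  intro h
  have h1 := h.unit_length () ()
  simp only [updateNormSq, halfHalf, Fintype.sum_unique] at h1
  norm_num at h1

/-- Amplitude table of the two-state **Hadamard walk** (`q₁ = true`, `q₂ = false`):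
`δ(q₁) = ½(|q₁,L⟩ + |q₂,L⟩ + |q₁,R⟩ - |q₂,R⟩)`, `δ(q₂) = ½(|q₁,L⟩ + |q₂,L⟩ - |q₁,R⟩ + |q₂,R⟩)`:
the left-going restricted superpositions are multiples of `|q₁⟩ + |q₂⟩`, the right-going ones of
`|q₁⟩ - |q₂⟩`. [folklore] -/
def hadamardWalkAmp : Bool → Bool → Dir → ℂ
  | _, _, Dir.left => 1 / 2
  | true, true, Dir.right => 1 / 2
  | true, false, Dir.right => -(1 / 2)
  | false, true, Dir.right => -(1 / 2)
  | false, false, Dir.right => 1 / 2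

/-- The two-state Hadamard walk over the one-symbol alphabet, started and accepting in `q₁`. [folklore] -/
def hadamardWalk : QTM where
  Λ := Bool
  Γ := Unit
  start := true
  accept := true
  embed := fun _ => ()
  δ := fun p _ q _ d => hadamardWalkAmp p q d

/-- The Hadamard walk satisfies unit length, orthogonality and separability, so it is a
well-formed QTM in Bernstein–Vazirani's sense (BV Thm. 5.3). [folklore] -/
theorem hadamardWalk_isLocallyWellFormed : hadamardWalk.IsLocallyWellFormed := by
  refine ⟨fun p σ => ?_, fun p₁ σ₁ p₂ σ₂ hne => ?_, fun p₁ σ₁ τ₁ p₂ σ₂ τ₂ => ?_⟩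
  · change ∑ q : Bool, ∑ τ : Unit, (‖hadamardWalkAmp p q Dir.left‖ ^ 2 +
      ‖hadamardWalkAmp p q Dir.right‖ ^ 2) = 1
    cases p <;> simp [hadamardWalkAmp] <;> norm_num
  · change ∑ q : Bool, ∑ τ : Unit, (hadamardWalkAmp p₁ q Dir.left *
      conj (hadamardWalkAmp p₂ q Dir.left) +
        hadamardWalkAmp p₁ q Dir.right * conj (hadamardWalkAmp p₂ q Dir.right)) = 0
    have hp : p₁ ≠ p₂ := fun h => hne (by cases σ₁; cases σ₂; rw [h])
    cases p₁ <;> cases p₂ <;> simp [hadamardWalkAmp] at hp ⊢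
  · change ∑ q : Bool, hadamardWalkAmp p₁ q Dir.left * conj (hadamardWalkAmp p₂ q Dir.right) = 0
    cases p₁ <;> cases p₂ <;> simp [hadamardWalkAmp]

/-- Hence the Hadamard walk is also well formed in the tree's model. [folklore] -/
theorem hadamardWalk_isWellFormed : hadamardWalk.IsWellFormed :=
  hadamardWalk_isLocallyWellFormed.isWellFormed

/-- **Translate interference.** In the tree's head-centred semantics one step of the Hadamard
walk FIXES the basis state `|q₁, T⟩`: the two translates `|q₁, ξ∓1⟩` (amplitude `½` each in
Bernstein–Vazirani's semantics) are one configuration of the tree, with amplitude `1`, and the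
translates `|q₂, ξ∓1⟩` (amplitudes `±½`) cancel. [folklore] -/
theorem hadamardWalk_evolve_single (T : Tape Unit) :
    hadamardWalk.evolve (Finsupp.single ⟨true, T⟩ 1) = Finsupp.single ⟨true, T⟩ 1 := by
  rw [evolve_single_eq_sum]
  have htgt : ∀ u : hadamardWalk.Upd, hadamardWalk.updTarget ⟨true, T⟩ u = ⟨u.2.1, T⟩ :=
    fun u => by
      simp only [updTarget]
      congr 1
      exact tape_unit_subsingleton.elim _ _
  have hamp : ∀ u : hadamardWalk.Upd,
      hadamardWalk.updAmp ⟨true, T⟩ u = hadamardWalkAmp true u.2.1 (dirOfBool u.1) :=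
    fun u => rfl
  simp_rw [htgt, hamp, one_mul, Finsupp.smul_single_one]
  change ∑ u : Bool × Bool × Unit, Finsupp.single (⟨u.2.1, T⟩ : hadamardWalk.Cfg)
    (hadamardWalkAmp true u.2.1 (dirOfBool u.1)) = _
  simp only [Fintype.sum_prod_type, Fintype.sum_bool, Fintype.sum_unique, dirOfBool_true,
    dirOfBool_false, hadamardWalkAmp]
  rw [add_add_add_comm, ← Finsupp.single_add, ← Finsupp.single_add,
    show (1 / 2 : ℂ) + 1 / 2 = 1 by norm_num, show (-(1 / 2) : ℂ) + 1 / 2 = 0 by norm_num,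
    Finsupp.single_zero, add_zero]

/-- Consequently, in the tree's semantics the Hadamard walk started on the empty input is
observed in its accepting control state `q₁` with probability `1` at EVERY time `t`, whereas in
Bernstein–Vazirani's semantics the probability at time `1` is `|½|² + |½|² = 1/2`: the tree's
`QTM.acceptProbAt` differs from Bernstein–Vazirani's acceptance probability for machines that
superpose translates. [folklore] -/
theorem hadamardWalk_acceptProbAt (t : ℕ) : hadamardWalk.acceptProbAt [] t = 1 := by
  have hstate : hadamardWalk.stateAt [] t = Finsupp.single (hadamardWalk.init []) 1 := by
    induction t with
    | zero => rfl
    | succ t ih =>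
      unfold stateAt at ih ⊢
      rw [Function.iterate_succ_apply', ih]
      exact hadamardWalk_evolve_single (Tape.mk₁ [])
  unfold acceptProbAt
  rw [hstate, Finsupp.sum_single_index (by simp)]
  simp [show (hadamardWalk.init []).q = hadamardWalk.accept from rfl]

end ModelExamples

end QTM

end Literature.Computability.Cryptography

end
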